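import Summits.AnomalousDissipation.AnomalousDissipation.Theses.TameRoughRigidity
import Summits.AnomalousDissipation.AnomalousDissipation.Theorems.TameToRough.Negative.Structure
import Summits.AnomalousDissipation.AnomalousDissipation.Theorems.TaylorCertificatesSteadyStatesLoudBoundedStubGpAdmissible
import Summits.AnomalousDissipation.AnomalousDissipation.Theorems.TameRoughRigidityTameClosure
import Summits.AnomalousDissipation.AnomalousDissipation.Theorems.TameRoughRigidityTameToRoughEvenSymmetrise
import Summits.AnomalousDissipation.AnomalousDissipation.Theorems.TameRoughRigidityTameToRoughOddWeightedBudget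
import Summits.AnomalousDissipation.AnomalousDissipation.Theorems.TameRoughRigidityTameToRoughWitnessFormSteps
import Literature.Analysis.FluidPDE.CylindricalGenerator
import HarnessLib

/-!
# The co-signed floor of line `Sketch` is a RESTATEMENT of the target — witness form of
# `TameRoughRigidity.TameToRough` (stmt-AnomalousDissipation-18401)

Lead prover of the crux R = `TameToRough` (conditional Onsager calibration), line `Sketch`
(card `Cruxes/TameToRough/Ideas/cosigned-flux-witness.md`). The line's registered open stub S2
`stub_coSignedFloor` says: under N = `GPEulerCoercive`, above an enstrophy threshold every EVEN admissible
near-statistics of `f_GP` with defect constant `R ≤ δ₀` admits an odd-weighted PRODUCT witness (even profile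
`|φ| ≤ K` times an odd compactly supported weight `|ψ| ≤ 1` of the same coordinates) of gradient cost `≤ 2√G`
and budget `≥ 2c`. This file proves that S2 is implied by the route's TARGET X = `GPStatisticalRigidity`
(`coSignedFloor_of_target`) and hence that S2 (with its hypothesis N) is EQUIVALENT TO THE CRUX
(`coSignedFloor_iff_tameToRough`: `→` is the line's glue through the landed S0 `stub_evenSymmetrise` and S1
`stub_oddWeightedBudget`; `←` is the refuter's `tameToRough_iff_imp : R ↔ (N → K → X)` with the landed
K = `TameClosure_of`): the product-witness language loses and gains nothing.

Proof of `coSignedFloor_of_target`. X at level `E` gives constants `(c, δ₀)`; put the threshold at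
`G ≥ max 1 (c/(2δ₀))²` and `D := c/(2√G) ≤ δ₀`. The given even `μ` cannot have defect constant `D` (X would give
`c ≤ D√G = c/2`), so some cylindrical `Θ` has `|∫⟨F₀, Θ'⟩ dμ| > D‖∇Θ'‖_{L²(μ;L²)}`. Split the profile
`θ = θₑ + θₒ` into even and odd parts: on the even measure the `θₑ`-part of the budget vanishes (odd integrand) and,
by the parallelogram law `‖∇Θ'(v)‖² + ‖∇Θ'(−v)‖² = 2‖∇Θₑ'‖² + 2‖∇Θₒ'‖²`, the cost of the odd part is at most that
of `Θ`; hence `|∫⟨F₀, Θₒ'⟩ dμ| > D‖∇Θₒ'‖ =: D Sₒ` and `Sₒ > 0` (`witnessForm_oddBeat`). The witness is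
`ψ := θₒ/K₀` (`K₀ > sup|θₒ|`) times the FAT EVEN BUMP `φ := λK₀ χ` with `χ ≡ 1` on a ball containing `supp θₒ`
and `|∇χ| ≤ ε`: its budget is EXACTLY `λ ∫⟨F₀, Θₒ'⟩ dμ` (where `ψ ≠ 0` the bump is flat, where the bump bends
`θₒ` and `∇θₒ` vanish) and its cost is `≤ λK₀ε√Γ + λSₒ ≤ 2λSₒ` for `ε` small, `Γ` a Gram constant of the test
fields (`witnessForm_build`); `λ := √G/Sₒ` gives cost `≤ 2√G` and budget `> λ D Sₒ = c/2`.

The two steps `witnessForm_oddBeat`, `witnessForm_build` are the landed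
`Theorems/TameRoughRigidityTameToRoughWitnessFormSteps.lean` (tools: `stub_witnessParityTools` p161179 — even
measures, odd/even parts of a profile, parallelogram/homogeneity/crude bound for test enstrophies — and
`stub_witnessBumpTools` p161056 — wide even `C¹` bumps with small gradient on `ℝᵐ`). This file ends with the
registered conjunction `stub_witnessFormEquiv`.

## References

* C. Foias, O. Manley, R. Rosa, R. Temam, *Navier–Stokes Equations and Turbulence*, CUP (2001), Ch. IV §1.2
  Def. 1.2–1.3. [FoiasManleyRosaTemam2001]
* `Cruxes/TameToRough/{STRATEGY-CENSUS.md (F2), Lines/Sketch.lean, Ideas/cosigned-flux-witness.md}`;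
  `Theorems/TameToRough/Negative/Structure.lean`.
-/

set_option linter.dupNamespace false

noncomputable section

namespace Summit.AnomalousDissipation.AnomalousDissipation.Theorems.TameRoughRigidity.TameToRough

open MeasureTheory Filter Topology UnitAddTorus
open scoped InnerProductSpace RealInnerProductSpace ENNReal NNReal
open Literature.Analysis.FunctionSpaces Literature.Analysis.FluidPDE
open Summit.AnomalousDissipation.AnomalousDissipation.Theses.TameRoughRigidity
open Summit.AnomalousDissipation.AnomalousDissipation.Theorems.GPStatisticalRigidity.Negative
open Summit.AnomalousDissipation.AnomalousDissipation.Theorems.TameToRough.Negative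
open Summit.AnomalousDissipation.AnomalousDissipation.Theorems.EnsembleRigidity.GPStatisticalRigidity

/-- Local notation: real vector fields on `T³`. -/
local notation "Vec3" => (UnitAddTorus (Fin 3)) → (EuclideanSpace ℝ (Fin 3))
/-- Local notation: `L²(T³; ℝ³)`. -/
local notation "L2" => (Lp (EuclideanSpace ℝ (Fin 3)) 2 (volume : Measure (UnitAddTorus (Fin 3))))
/-- Local notation: the energy space `H`. -/
local notation "H3" => (Torus.energySpace (Fin 3))

/-! ### The target implies the co-signed floor -/

/-- **X ⇒ S2.** Statistical Lamb rigidity of `f_GP` (the route's target `GPStatisticalRigidity`) implies the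
co-signed floor of line `Sketch` at every level: above the threshold `max 1 (c/(2δ₀))²` every even admissible
near-statistics carries an odd-weighted product witness of cost `≤ 2√G` and budget `≥ 2·(c/4)`. -/
theorem coSignedFloor_of_target (hX : GPStatisticalRigidity) (E : ℝ) :
    ∃ G₁ c δ₀ : ℝ, 0 < c ∧ 0 < δ₀ ∧ ∀ μ : Measure H3, IsProbabilityMeasure μ →
      Integrable (fun v : H3 => ‖v‖ ^ 2) μ → Torus.ensembleEnergy μ ≤ E → Torus.ensembleEnstrophy μ < ⊤ →
      ENNReal.ofReal G₁ ≤ Torus.ensembleEnstrophy μ → ShellWorkNonneg gpForce μ →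
      μ.map (fun v : H3 => -v) = μ →
      ∀ R : ℝ, 0 ≤ R → R ≤ δ₀ → DefectLE gpForce μ R →
        ∃ (Φ : Torus.CylindricalTest (Fin 3)) (ψ : EuclideanSpace ℝ (Fin Φ.m) → ℝ) (K : ℝ),
          ContDiff ℝ 1 ψ ∧ HasCompactSupport ψ ∧ (∀ c, |ψ c| ≤ 1) ∧ (∀ c, ψ (-c) = -ψ c) ∧
          (∀ c, Φ.φ (-c) = Φ.φ c) ∧ (∀ c, |Φ.φ c| ≤ K) ∧
          Real.sqrt (∫ v, Torus.gradNormSq (Φ.grad v) ∂μ) +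
              K * Real.sqrt (∫ v, Torus.gradNormSq
                (fun x => ∑ i, (fderiv ℝ ψ (Φ.coords v) (EuclideanSpace.single i 1)) • Φ.g i x) ∂μ) ≤
            2 * Real.sqrt (Torus.ensembleEnstrophy μ).toReal ∧
          2 * c ≤ |∫ v, (ψ (Φ.coords v) * Torus.nsGeneratorPairing 0 gpForce v (Φ.grad v) +
              Φ.eval v * Torus.nsGeneratorPairing 0 gpForce v
                (fun x => ∑ i, (fderiv ℝ ψ (Φ.coords v) (EuclideanSpace.single i 1)) • Φ.g i x)) ∂μ| := by
  obtain ⟨c, δ₀, hc, hδ₀, hrig⟩ := rigid_of_crux hX E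
  refine ⟨max 1 ((c / (2 * δ₀)) ^ 2), c / 4, δ₀, by positivity, hδ₀, ?_⟩
  intro μ hprob hint hE hfin hth hshell heven R _hR0 _hRδ hdef
  haveI := hprob
  obtain ⟨hsm, -, -⟩ :=
    Summit.AnomalousDissipation.AnomalousDissipation.Theorems.SteadyStatesLoudBounded.GpAdmissible.stub_gpAdmissible
  have hfint : Integrable gpForce volume := hsm.integrable
  -- the enstrophy level `G ≥ 1`, `G ≥ (c/(2δ₀))²`
  have hfinne : Torus.ensembleEnstrophy μ ≠ ⊤ := hfin.ne
  have hth' : max 1 ((c / (2 * δ₀)) ^ 2) ≤ (Torus.ensembleEnstrophy μ).toReal :=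
    (ENNReal.ofReal_le_iff_le_toReal hfinne).1 hth
  set G : ℝ := (Torus.ensembleEnstrophy μ).toReal with hG
  have hG1 : 1 ≤ G := le_trans (le_max_left _ _) hth'
  have hGc : (c / (2 * δ₀)) ^ 2 ≤ G := le_trans (le_max_right _ _) hth'
  have hsG1 : 1 ≤ Real.sqrt G := by
    rw [← Real.sqrt_one]; exact Real.sqrt_le_sqrt hG1
  have hsGpos : 0 < Real.sqrt G := by linarith
  -- the forbidden defect constant `D = c/(2√G) ≤ δ₀`
  set D : ℝ := c / (2 * Real.sqrt G) with hD
  have hD0 : 0 ≤ D := by positivity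
  have hDδ : D ≤ δ₀ := by
    have h1 : c / (2 * δ₀) ≤ Real.sqrt G := by
      have h0 : 0 ≤ c / (2 * δ₀) := by positivity
      calc c / (2 * δ₀) = Real.sqrt ((c / (2 * δ₀)) ^ 2) := (Real.sqrt_sq h0).symm
        _ ≤ Real.sqrt G := Real.sqrt_le_sqrt hGc
    rw [hD, div_le_iff₀ (by positivity)]
    rw [div_le_iff₀ (by positivity)] at h1
    linarith
  have hDG : D * Real.sqrt G = c / 2 := by
    rw [hD]; field_simp
  have hnot : ¬ DefectLE gpForce μ D := fun hD' => by
    have h := hrig μ hprob hint hE hfin hshell D hD0 hDδ hD'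
    rw [hDG] at h
    linarith
  -- a cylindrical test beating the constant `D`, then its odd part
  obtain ⟨Θ, hΘ⟩ : ∃ Θ : Torus.CylindricalTest (Fin 3),
      D * Real.sqrt (∫ v, Torus.gradNormSq (Θ.grad v) ∂μ) <
        |∫ v, Torus.nsGeneratorPairing 0 gpForce v (Θ.grad v) ∂μ| := by
    by_contra hall
    push Not at hall
    exact hnot fun Θ' => ⟨(hdef Θ').1, hall Θ'⟩
  obtain ⟨Θo, hodd, hbd, hvan, hSopos, hBgt⟩ := witnessForm_oddBeat μ heven hfint hD0 hdef Θ hΘ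
  set So : ℝ := Real.sqrt (∫ v, Torus.gradNormSq (Θo.grad v) ∂μ) with hSo
  -- the witness at scale `λ = √G/Sₒ`
  have hlam : 0 < Real.sqrt G / So := div_pos hsGpos hSopos
  have hlamSo : Real.sqrt G / So * So = Real.sqrt G := div_mul_cancel₀ _ hSopos.ne'
  obtain ⟨Φ, ψ, K, h1, h2, h3, h4, h5, h6, hcost, hbud⟩ :=
    witnessForm_build μ hfint Θo hodd hbd hvan hSopos hlam
  refine ⟨Φ, ψ, K, h1, h2, h3, h4, h5, h6, ?_, ?_⟩
  · calc _ ≤ 2 * (Real.sqrt G / So * So) := hcost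
      _ = 2 * Real.sqrt (Torus.ensembleEnstrophy μ).toReal := by rw [hlamSo]
  · rw [hbud]
    have h7 : Real.sqrt G / So * (D * So) < Real.sqrt G / So * |∫ v,
        Torus.nsGeneratorPairing 0 gpForce v (Θo.grad v) ∂μ| := mul_lt_mul_of_pos_left hBgt hlam
    have h8 : Real.sqrt G / So * (D * So) = c / 2 := by
      calc Real.sqrt G / So * (D * So) = D * (Real.sqrt G / So * So) := by ring
        _ = D * Real.sqrt G := by rw [hlamSo]
        _ = c / 2 := hDG
    linarith


/-! ### The co-signed floor is the crux -/

/-- **S2 ↔ R.** The registered open stub of line `Sketch` — the co-signed floor under N — is EQUIVALENT to the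
crux `TameToRough`. (→): the tame gap gives N (`tameGap_iff`); symmetrise (S0 `stub_evenSymmetrise`), take the
witness, bound its budget by the defect at the critical tolerance (S1 `stub_oddWeightedBudget`), divide by two.
(←): R with N and the landed K (`TameClosure_of`) gives X (`tameToRough_iff_imp`), and X gives the floor
(`coSignedFloor_of_target`). -/
theorem coSignedFloor_iff_tameToRough :
    (GPEulerCoercive → ∀ E : ℝ,
      ∃ G₁ c δ₀ : ℝ, 0 < c ∧ 0 < δ₀ ∧ ∀ μ : Measure H3, IsProbabilityMeasure μ →
        Integrable (fun v : H3 => ‖v‖ ^ 2) μ → Torus.ensembleEnergy μ ≤ E → Torus.ensembleEnstrophy μ < ⊤ →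
        ENNReal.ofReal G₁ ≤ Torus.ensembleEnstrophy μ → ShellWorkNonneg gpForce μ →
        μ.map (fun v : H3 => -v) = μ →
        ∀ R : ℝ, 0 ≤ R → R ≤ δ₀ → DefectLE gpForce μ R →
          ∃ (Φ : Torus.CylindricalTest (Fin 3)) (ψ : EuclideanSpace ℝ (Fin Φ.m) → ℝ) (K : ℝ),
            ContDiff ℝ 1 ψ ∧ HasCompactSupport ψ ∧ (∀ c, |ψ c| ≤ 1) ∧ (∀ c, ψ (-c) = -ψ c) ∧
            (∀ c, Φ.φ (-c) = Φ.φ c) ∧ (∀ c, |Φ.φ c| ≤ K) ∧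
            Real.sqrt (∫ v, Torus.gradNormSq (Φ.grad v) ∂μ) +
                K * Real.sqrt (∫ v, Torus.gradNormSq
                  (fun x => ∑ i, (fderiv ℝ ψ (Φ.coords v) (EuclideanSpace.single i 1)) • Φ.g i x) ∂μ) ≤
              2 * Real.sqrt (Torus.ensembleEnstrophy μ).toReal ∧
            2 * c ≤ |∫ v, (ψ (Φ.coords v) * Torus.nsGeneratorPairing 0 gpForce v (Φ.grad v) +
                Φ.eval v * Torus.nsGeneratorPairing 0 gpForce v
                  (fun x => ∑ i, (fderiv ℝ ψ (Φ.coords v) (EuclideanSpace.single i 1)) • Φ.g i x)) ∂μ|) ↔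
    TameToRough := by
  constructor
  · intro hS2 f hf gap E
    subst hf
    -- the tame gap implies N (and K): refuter's structure theorem
    have hN : GPEulerCoercive := (tameGap_iff.1 gap).1
    obtain ⟨G₁, c, δ₀, hc, hδ₀, hfloor⟩ := hS2 hN E
    refine ⟨G₁, c, δ₀, hc, hδ₀, ?_⟩
    intro μ hprob hint hE hfin hth _hshell R hR0 hRδ hdef
    obtain ⟨hsm, -, -⟩ :=
      Summit.AnomalousDissipation.AnomalousDissipation.Theorems.SteadyStatesLoudBounded.GpAdmissible.stub_gpAdmissible
    have hf2 : MemLp gpForce 2 volume := hsm.memLp 2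
    -- S0: symmetrise
    obtain ⟨μ', hprob', hint', hE', hG', heven, hshell', hdef'⟩ :=
      stub_evenSymmetrise gpForce hf2 μ hprob hint R hR0 hdef
    have hEle : Torus.ensembleEnergy μ' ≤ E := hE'.symm ▸ hE
    have hfin' : Torus.ensembleEnstrophy μ' < ⊤ := hG'.symm ▸ hfin
    have hth' : ENNReal.ofReal G₁ ≤ Torus.ensembleEnstrophy μ' := hG'.symm ▸ hth
    -- S2: the odd-weighted product witness on the even measure
    obtain ⟨Φ, ψ, K, hψ, hψc, hψ1, -, -, hφK, hcost, hbudget⟩ :=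
      hfloor μ' hprob' hint' hEle hfin' hth' hshell' heven R hR0 hRδ hdef'
    -- S1: its budget is bounded by the defect at the critical tolerance
    have hS1 := stub_oddWeightedBudget gpForce hsm μ' hprob' R K hR0 hdef' Φ ψ hψ hψc hψ1 hφK
    rw [hG'] at hcost
    have key : 2 * c ≤ R * (2 * Real.sqrt (Torus.ensembleEnstrophy μ).toReal) :=
      hbudget.trans (hS1.trans (mul_le_mul_of_nonneg_left hcost hR0))
    linarith
  · intro hR hN E
    have hX : GPStatisticalRigidity := tameToRough_iff_imp.1 hR hN TameClosure.TameClosure_of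
    exact coSignedFloor_of_target hX E


/-! ### The registered conjunction -/

/-- **`stub_witnessFormEquiv`** — X ⇒ S2 and S2 ↔ R, as registered on the crux. -/
theorem stub_witnessFormEquiv :
    (GPStatisticalRigidity → ∀ E : ℝ,
      ∃ G₁ c δ₀ : ℝ, 0 < c ∧ 0 < δ₀ ∧ ∀ μ : Measure H3, IsProbabilityMeasure μ →
        Integrable (fun v : H3 => ‖v‖ ^ 2) μ → Torus.ensembleEnergy μ ≤ E → Torus.ensembleEnstrophy μ < ⊤ →
        ENNReal.ofReal G₁ ≤ Torus.ensembleEnstrophy μ → ShellWorkNonneg gpForce μ →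
        μ.map (fun v : H3 => -v) = μ →
        ∀ R : ℝ, 0 ≤ R → R ≤ δ₀ → DefectLE gpForce μ R →
          ∃ (Φ : Torus.CylindricalTest (Fin 3)) (ψ : EuclideanSpace ℝ (Fin Φ.m) → ℝ) (K : ℝ),
            ContDiff ℝ 1 ψ ∧ HasCompactSupport ψ ∧ (∀ c, |ψ c| ≤ 1) ∧ (∀ c, ψ (-c) = -ψ c) ∧
            (∀ c, Φ.φ (-c) = Φ.φ c) ∧ (∀ c, |Φ.φ c| ≤ K) ∧
            Real.sqrt (∫ v, Torus.gradNormSq (Φ.grad v) ∂μ) +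
                K * Real.sqrt (∫ v, Torus.gradNormSq
                  (fun x => ∑ i, (fderiv ℝ ψ (Φ.coords v) (EuclideanSpace.single i 1)) • Φ.g i x) ∂μ) ≤
              2 * Real.sqrt (Torus.ensembleEnstrophy μ).toReal ∧
            2 * c ≤ |∫ v, (ψ (Φ.coords v) * Torus.nsGeneratorPairing 0 gpForce v (Φ.grad v) +
                Φ.eval v * Torus.nsGeneratorPairing 0 gpForce v
                  (fun x => ∑ i, (fderiv ℝ ψ (Φ.coords v) (EuclideanSpace.single i 1)) • Φ.g i x)) ∂μ|) ∧
    ((GPEulerCoercive → ∀ E : ℝ,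
      ∃ G₁ c δ₀ : ℝ, 0 < c ∧ 0 < δ₀ ∧ ∀ μ : Measure H3, IsProbabilityMeasure μ →
        Integrable (fun v : H3 => ‖v‖ ^ 2) μ → Torus.ensembleEnergy μ ≤ E → Torus.ensembleEnstrophy μ < ⊤ →
        ENNReal.ofReal G₁ ≤ Torus.ensembleEnstrophy μ → ShellWorkNonneg gpForce μ →
        μ.map (fun v : H3 => -v) = μ →
        ∀ R : ℝ, 0 ≤ R → R ≤ δ₀ → DefectLE gpForce μ R →
          ∃ (Φ : Torus.CylindricalTest (Fin 3)) (ψ : EuclideanSpace ℝ (Fin Φ.m) → ℝ) (K : ℝ),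
            ContDiff ℝ 1 ψ ∧ HasCompactSupport ψ ∧ (∀ c, |ψ c| ≤ 1) ∧ (∀ c, ψ (-c) = -ψ c) ∧
            (∀ c, Φ.φ (-c) = Φ.φ c) ∧ (∀ c, |Φ.φ c| ≤ K) ∧
            Real.sqrt (∫ v, Torus.gradNormSq (Φ.grad v) ∂μ) +
                K * Real.sqrt (∫ v, Torus.gradNormSq
                  (fun x => ∑ i, (fderiv ℝ ψ (Φ.coords v) (EuclideanSpace.single i 1)) • Φ.g i x) ∂μ) ≤
              2 * Real.sqrt (Torus.ensembleEnstrophy μ).toReal ∧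
            2 * c ≤ |∫ v, (ψ (Φ.coords v) * Torus.nsGeneratorPairing 0 gpForce v (Φ.grad v) +
                Φ.eval v * Torus.nsGeneratorPairing 0 gpForce v
                  (fun x => ∑ i, (fderiv ℝ ψ (Φ.coords v) (EuclideanSpace.single i 1)) • Φ.g i x)) ∂μ|) ↔
      TameToRough) :=
  ⟨coSignedFloor_of_target, coSignedFloor_iff_tameToRough⟩

end Summit.AnomalousDissipation.AnomalousDissipation.Theorems.TameRoughRigidity.TameToRough

end
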